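import Literature.NumberTheory.DiophantineGeometry.KoizumiOfWeilChunk
import Literature.AlgebraicGeometry.GroupSchemes.WeilGroupChunk

/-!
# Koizumi's good-reduction theorem (road W closed)

Road W of the `hodgecm-mathlib` cell (Néron capital banked next to the closed crux H21 ★ p633027):
`koizumi_reductionAt_of_weilChunk (hW1)` ★ p645400 is Koizumi's theorem at every finite place modulo the single head
(W1) = Weil's group-chunk theorem over a complete DVR with algebraically closed residue field (W1cProbe-v6 text
`WeilGroupChunkStrictlyLocal`).  This file DISCHARGES (W1) by the theorem
`Literature.AlgebraicGeometry.GroupSchemes.weilGroupChunk_strictlyLocal` (A-p06 table: Artin's gluing step ★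
`exists_isStrict_weilGluingStep`, noetherian induction `weilGluing_stageSaturated`, saturation ★
`BirationalGroupLaw.toRationalMap_domain_eq_top_of_strict`, Artin 2.5 `groupLawOfSaturated`, maximalisation
`BirationalGroupLaw.exists_isStrict_maximal`, measure increase ★ `BirationalGroupLaw.sectionSlice_mem_domain_comp`, W1d ★
`groupChunkOfGluing`, W1e ★ `Smoothening.exists_section_apply_mem_fibre`).  No hypothesis remains.

HC_CM is proved only modulo the 7 printed citations until rung 0 closes; road W is banked capital (0 floor distance).
-/

set_option autoImplicit false

noncomputable section

open CategoryTheory CategoryTheory.Limits AlgebraicGeometry MonoidalCategory CartesianMonoidalCategory MonObj GrpObj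
open scoped CategoryTheory.Obj
open IsDedekindDomain IsDedekindDomain.HeightOneSpectrum
open scoped NumberField
open Literature Literature.AlgebraicGeometry.Motives Literature.NumberTheory.EllipticCurves
  Literature.AlgebraicGeometry.GroupSchemes Literature.RingTheory.DiscreteValuationRing

namespace Literature.NumberTheory.DiophantineGeometry

/-- **Koizumi's theorem at a finite place** ([Koizumi1960, Thm. p. 377]; [BLRNeronModels1990, §1.2 Prop. 8 with §1.4 Thm. 3,
§4.3 Prop. 6, §5.1 Thm. 5 and §6.5 Cor. 3]; [Artin1986NeronModels, Thm. (1.12)]): for a number field `K`, an abelian variety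
`A / K`, a finite place `v` and an integral model `𝒳` of `A.X` over `𝓞_{K,(v)}` that is smooth of relative dimension `dim A`
and proper, the total space of `𝒳` carries an `𝓞_{K,(v)}`-group-scheme structure making it an abelian-scheme model of `A`
at `v` (so `A` has good reduction at `v` as soon as it has a smooth proper model there).  Proof:
`koizumi_reductionAt_of_weilChunk` ★ p645400 with (W1) := `weilGroupChunk_strictlyLocal` ★.
[cite: Koizumi1960, Thm. p. 377] [cite: BLRNeronModels1990, §1.2 Prop. 8, §4.3 Prop. 6, §5.1 Thm. 5, §6.5 Cor. 3]
[cite: Artin1986NeronModels, Thm. (1.12)] [cite: EdixhovenRomagny2012, Thm. 6.3] -/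
theorem koizumi_reductionAt
    {K : Type} [Field K] [NumberField K] (A : AbelianVariety K) (v : HeightOneSpectrum (𝓞 K))
    (𝒳 : IntegralModel (valuationSubringAtPrime K v) K A.X) (h𝒳 : 𝒳.IsSmoothProper A.dim) :
    ∃ _ : GrpObj 𝒳.total, IsAbelianSchemeModel A v 𝒳.total :=
  koizumi_reductionAt_of_weilChunk
    (fun R _ _ _ _ _ hk 𝒳 _ _ _ _ L hL => weilGroupChunk_strictlyLocal (R := R) hk 𝒳 L hL) A v 𝒳 h𝒳

end Literature.NumberTheory.DiophantineGeometry

end
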